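import Literature.AlgebraicGeometry.ProjectiveGeometry.RelativeEmbeddingNearFibre
import Literature.AlgebraicGeometry.AbelianSchemes.LDeltaAmpleLocusOpen
import Literature.AlgebraicGeometry.Limits.ConstructibleEmptyGenericFibre
import Mathlib.FieldTheory.IsAlgClosed.AlgebraicClosure
import HarnessLib

/-!
# A polarised abelian scheme is embedded into `ℙ^m` by sections of `L^Δ(λ)^{⊗3}` over a ZARISKI OPEN NEIGHBOURHOOD of every point of
# characteristic `0` of a mixed-characteristic base («REL-EMB-SPREAD»); over a Dedekind base of characteristic `0` the uncovered
# closed set lies over FINITELY MANY primes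

Layer `Literature/AlgebraicGeometry/AbelianSchemes`, namespace `Literature.AlgebraicGeometry.AbelianSchemes.AbelianSchemeOver`.  THEOREMS ONLY
(no definition, no named fact, no instance, no notation, no `sorry`); universe `Scheme.{0}`.  Cell `hodgecm-mathlib` (D-0151), P6 «MOD programme»,
organ «REL-EMB-SPREAD» FILE 2∕2 (LEAD F0P6-plan (g2) 2026-09-01 22:51:15Z (2)(F1), 22:52:19Z; spec A-p14 (g34) SP3-a2 census 485f21e1 §0 (F1) + §3
binder (I-EMB); B-p10 (g29)).  Consumer: the (I-EMB) binder of `Cruxes/HLiu418/Lines/F0_P6a_IsomSchemeFiniteType.lean` (closed `U_k`-immersions of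
`𝒜|_{U_k}` into `ℙ^m_{U_k}` with `𝒪(1) ↦ L^Δ(λ)^{⊗3}`), discharged inside `stub_PEL` at a cofinal stage: the finite prime set of §4 joins `S_M`.
Count-neutral: HC_CM is proved only modulo the printed citations until rung 0 closes — nothing here bears on a summit.

WHY NO CHAR-`p` LEFSCHETZ AND NO LIMIT ARGUMENT ARE NEEDED.  [EGAIII1] Thm. (4.7.1) spreads a closed embedding from ONE fibre to a Zariski open
of the base; in the tree's flat + `H¹` spine (★ `ProjectiveGeometry/RelativeEmbeddingNearFibre.exists_affineOpen_isClosedImmersion_toProj`) its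
hypotheses are fibre-only: at a point `x` of characteristic `0` the geometric fibre `A_x̄` is embedded by any spanning family of sections of
`L^Δ(λ)^{⊗3}|` ([MumfordAV1970] §17 Lefschetz, ★ `isClosedImmersion_toProj_of_iso_lineBundle_three_nsmul`, `CharZero` IN THE TREE) and
`H¹(A_x̄, L^Δ(λ)^{⊗3}|) = 0` ([MumfordAV1970] §16, ★ `subsingleton_ext_one_lineBundle_of_symmetric_isAmple`, any characteristic); the open the
theorem returns is an open of the MIXED-characteristic base, its char-`p` points included.

* §1 `subsingleton_ext_and_exists_toProj_tensorPow_three_of_symmetric_isAmple` — the two fibre inputs at a char-`0` field point with a symmetric ample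
  witness `L|_{A_x̄} ≅ 𝒪(Θ)` (the internals of ★ `AbelianSchemeAmpleLocusOpen` §2, exposed): `H¹ = 0` and a finite spanning family of sections of
  `L^{⊗3}|` embedding `A_x̄` ([MumfordAV1970] §5 Cor. 2 for the finiteness, ★ `finite_and_projective_secMod_top_of_forall_fiber`).
* §2 **`exists_affineOpen_isClosedImmersion_toProj_tensorPow_three_of_symmetric_isAmple`** (rank-one `L`, symmetric ample char-`0` witness),
  **`…_LDelta_three_of_isLambdaOfAt`** (`L := L^Δ(λ) = Gr^*𝒫`, witness `λ̄ = Λ(𝒪(Θ))` with `Θ` ample at an algebraically closed char-`0` point,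
  ★ `detClass_restrict_LDelta_eq_cechClass_add_pullback_neg`), **`…_LDelta_three_of_polarization`** (`pol : 𝒜.Polarization D`, at any `x` with
  `CharZero (T.residueField x)`): a Noetherian ring `R`, an affine OPEN IMMERSION `ι : Spec R → T` through `x`, and for EVERY cartesian square
  `A′ = A ×_T Spec R` finitely many sections of `L^{⊗3}|_{A′}` generating it whose morphism `A′ → ℙ^m_R` over `Spec R` is a CLOSED IMMERSION
  (`𝒪(1) ↦ L^{⊗3}|` by ★ `nonempty_twistMod_toProj_iso`).
* §3 `charZero_residueField_of_apply_eq_bot` — over `q : T → Spec B` (`B` a domain of characteristic `0`), points over the generic point have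
  residue fields of characteristic `0`.
* §4 **`exists_opens_finite_image_compl_forall_affineOpen_isClosedImmersion_toProj`** — THE SPREAD over a Dedekind base: `T` Noetherian,
  `q : T → Spec B` locally of finite type, `B` Dedekind of characteristic `0`, `pol` a polarisation of `𝒜/T`: an OPEN `𝒱 ⊆ T` such that
  `q(T ∖ 𝒱)` is a FINITE set of primes ([EGAIV3] (9.2), ★ SP3-b `finite_image_of_isConstructible_of_bot_notMem_of_finiteType`: `T ∖ 𝒱` is closed,
  hence constructible in the Noetherian `T`, and misses the generic fibre by §3 + §2) and every `t ∈ 𝒱` has a §2-chart `Spec R ↪ 𝒱` through it.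

## References
* [EGAIII1] A. Grothendieck, J. Dieudonné, *EGA III₁* (1961), Thm. (4.7.1) (p. 145).
* [EGAIV3] A. Grothendieck, J. Dieudonné, *EGA IV₃* (1966), (9.2.1)–(9.2.3).
* [MumfordAV1970] D. Mumford, *Abelian Varieties* (1970), §5 Cor. 2–3 (pp. 50–53), §16 (the vanishing theorem), §17 (Lefschetz).
* [MumfordFogartyKirwan1994] D. Mumford, J. Fogarty, F. Kirwan, *Geometric Invariant Theory*, 3rd ed. (1994), Ch. 6 §2 Def. 6.3 (p. 120),
  Prop. 6.10 (p. 121); Ch. 7 §2 Prop. 7.6 (p. 136).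
* [GortzWedhorn2023] U. Görtz, T. Wedhorn, *Algebraic Geometry II* (2023), Thm. 24.46 (p. 397), Rem. 27.185.
* [StacksProject] The Stacks Project, Tags 0D2N, 00FE, 054J.
-/

noncomputable section

-- `TopCat.Presheaf`/`Scheme.Modules` and pull-back bookkeeping (as in ★ `AbelianSchemes/AbelianSchemeAmpleLocusOpen`).
set_option backward.isDefEq.respectTransparency false

open CategoryTheory CategoryTheory.Limits CategoryTheory.Abelian AlgebraicGeometry TopologicalSpace Opposite

namespace Literature.AlgebraicGeometry.AbelianSchemes

namespace AbelianSchemeOver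

open Literature.AlgebraicGeometry.Morphisms Literature.AlgebraicGeometry.Modules Literature.AlgebraicGeometry.Motives
open Literature.AlgebraicGeometry.Motives.GeneratingSections Literature.AlgebraicGeometry.AbelianVarieties
open Literature.AlgebraicGeometry.Limits _root_.Topology

/-- `Ext`-vanishing transports along an isomorphism of the second argument. [folklore] -/
private theorem subsingleton_ext_of_iso₄ {C : Type*} [Category C] [Abelian C] [HasExt.{1} C] (P : C) {Y Y' : C}
    (e : Y ≅ Y') (i : ℕ) (h : Subsingleton (Ext.{1} P Y' i)) : Subsingleton (Ext.{1} P Y i) := by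
  refine subsingleton_of_forall_eq 0 fun x => ?_
  have hx : x = (x.comp (Ext.mk₀ e.hom) (add_zero i)).comp (Ext.mk₀ e.inv) (add_zero i) := by
    rw [Ext.comp_assoc_of_second_deg_zero, Ext.mk₀_comp_mk₀, e.hom_inv_id, Ext.comp_mk₀_id]
  rw [hx, Subsingleton.elim (x.comp (Ext.mk₀ e.hom) (add_zero i)) 0, Ext.zero_comp]

/-! ## §1 The two fibre inputs at a char-`0` point with a symmetric ample witness -/

section FibreInputs

variable {T : Scheme.{0}} (𝒜 : AbelianSchemeOver T) (L : 𝒜.X.left.Modules) (hL : HasRank L 1)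
  (F : FrameSystem (tensorPow L 3)) (h1 : ∀ x, F.rank x = 1)
  {Ω : Type} [Field Ω] [CharZero Ω] (xb : Spec (.of Ω) ⟶ T)
  {Θ : CartierDivisor (𝒜.fibre xb).toAbelianVariety.X.left} (hΘ : Θ.IsAmple)
  (hsym : (Θ.pullback (AbelianVariety.Hom.toSchemeHom (-𝟙 (𝒜.fibre xb).toAbelianVariety))).LinEquiv Θ)
  (e : Nonempty ((Scheme.Modules.pullback (pullback.fst 𝒜.X.hom xb)).obj L ≅ 𝒜.lineBundleOfDivisor xb Θ))

include hL hΘ hsym e in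
/-- **THE FIBRE INPUTS AT A CHAR-`0` SYMMETRIC AMPLE WITNESS**: if `L|_{A_x̄} ≅ 𝒪(Θ)` with `Θ` ample and symmetric (`Ω` a field of
characteristic `0`), then `E := L^{⊗3}` restricted to `A_x̄` (i) has `Ext¹(𝒪, E|) = 0` ([MumfordAV1970] §16 for the symmetric ample `3Θ`,
★ `subsingleton_ext_one_lineBundle_of_symmetric_isAmple`; `E| ≅ 𝒪(3Θ)` by classes in `Ȟ¹`) and (ii) is embedded into some `ℙⁿ_Ω` by finitely many of its own
sections generating it ([MumfordAV1970] §17 Lefschetz, ★ `isClosedImmersion_toProj_of_iso_lineBundle_three_nsmul`, fed with a finite spanning family —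
[MumfordAV1970] §5 Cor. 2, ★ `finite_and_projective_secMod_top_of_forall_fiber` on `A_x̄ → Spec Ω`), read in the frames `F|_{A_x̄}`.
[cite: MumfordAV1970, §16 (the vanishing theorem), §17 (Lefschetz) and §5 Cor. 2–3 (pp. 50–53)] [cite: MumfordFogartyKirwan1994, Ch. 7 §2 Prop. 7.6 (p. 136)] -/
theorem subsingleton_ext_and_exists_toProj_tensorPow_three_of_symmetric_isAmple :
    Subsingleton (Ext.{1} (unitModule (pullback 𝒜.X.hom xb))
        ((Scheme.Modules.pullback (pullback.fst 𝒜.X.hom xb)).obj (tensorPow L 3)) 1) ∧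
      ∃ (n : ℕ) (s : Fin (n + 1) → Γ((Scheme.Modules.pullback (pullback.fst 𝒜.X.hom xb)).obj (tensorPow L 3), ⊤))
        (hcov : ⨆ i, ⨆ z, (pullback 𝒜.X.hom xb).basicOpen ((CocycleSections.ofFrameSystem (F.pullback (pullback.fst 𝒜.X.hom xb))
          (fun z ↦ h1 ((pullback.fst 𝒜.X.hom xb).base z)) s).coeff i z) = ⊤),
        IsClosedImmersion ((ofCocycleSections (F.pullback (pullback.fst 𝒜.X.hom xb)).U (CocycleSections.ofFrameSystem
          (F.pullback (pullback.fst 𝒜.X.hom xb)) (fun z ↦ h1 ((pullback.fst 𝒜.X.hom xb).base z)) s) hcov).toProj (pullback.snd 𝒜.X.hom xb)) := by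
  classical
  haveI : IsProper 𝒜.X.hom := 𝒜.isProper
  haveI : Smooth 𝒜.X.hom := 𝒜.isSmooth
  have hL₁ : IsFiniteLocallyFree L := HasRank.isFiniteLocallyFree' hL
  have hE : HasRank (tensorPow L 3) 1 := hasRank_tensorPow_one hL 3
  let B : AbelianVariety Ω := (𝒜.fibre xb).toAbelianVariety
  haveI : IsIntegral B.X.left :=
    haveI := B.geometricallyIntegral
    GeometricallyIntegral.isIntegral_of_subsingleton B.X.hom
  haveI : IsIntegral (pullback 𝒜.X.hom xb) := ‹IsIntegral B.X.left›
  let pr : B.X.left ⟶ 𝒜.X.left := pullback.fst 𝒜.X.hom xb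
  let f₁ : B.X.left ⟶ Spec (.of Ω) := pullback.snd 𝒜.X.hom xb
  haveI : IsProper f₁ := MorphismProperty.pullback_snd (P := @IsProper) _ _ inferInstance
  haveI : Flat f₁ := MorphismProperty.pullback_snd (P := @Flat) _ _ inferInstance
  obtain ⟨e⟩ := e
  let EB : B.X.left.Modules := (Scheme.Modules.pullback pr).obj (tensorPow L 3)
  have hEB : IsFiniteLocallyFree EB := (isFiniteLocallyFree_tensorPow hL₁ 3).pullback pr
  obtain ⟨e3⟩ : Nonempty (EB ≅ lineBundle (3 • Θ).toUnitCocycle) := by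
    refine (nonempty_iso_iff_detClass_eq (hasRank_pullback pr hE) (3 • Θ).toUnitCocycle.hasRank_lineBundle hEB
      (3 • Θ).toUnitCocycle.isFiniteLocallyFree_lineBundle).2 ?_
    rw [detClass_lineBundle_toUnitCocycle, cechClass_smul', ← detClass_eq_cechClass_of_iso e (hL₁.pullback pr),
      detClass_pullback (hE := hL₁), detClass_pullback (hE := isFiniteLocallyFree_tensorPow hL₁ 3), detClass_tensorPow hL hL₁ 3, map_pow]
    rfl
  -- (i) `H¹ = 0`
  have hsym3 : ((3 • Θ).pullback (AbelianVariety.Hom.toSchemeHom (-𝟙 B))).LinEquiv (3 • Θ) := by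
    rw [← AbelianVarieties.symmetric_iff_pullback_neg_id_linEquiv (X := B) _] at hsym ⊢
    exact AbelianVarieties.symmetric_nsmul hsym 3
  have hvan : Subsingleton (Ext.{1} (unitModule B.X.left) EB 1) := by
    haveI := B.subsingleton_ext_one_lineBundle_of_symmetric_isAmple (3 • Θ) (hΘ.smul (by norm_num)) hsym3
    exact subsingleton_ext_of_iso₄ (unitModule B.X.left) e3 1 inferInstance
  refine ⟨hvan, ?_⟩
  -- (ii) a finite spanning family of `Γ(B, E|_B)` ([MumfordAV1970] §5 Cor. 2 on `B → Spec Ω`)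
  have hvan₀ : ∀ y : Spec (.of Ω), Subsingleton (Ext.{1} (unitModule (f₁.fiber y))
      ((Scheme.Modules.pullback (f₁.fiberι y)).obj EB) 1) := by
    intro y
    obtain ⟨ψ, hψ⟩ := Spec.map_surjective ((Spec (.of Ω)).fromSpecResidueField y)
    have Hy : IsPullback (f₁.fiberι y) (f₁.fiberToSpecResidueField y) f₁ (Spec.map (CommRingCat.ofHom ψ.hom)) := by
      change IsPullback _ _ _ (Spec.map ψ)
      rw [hψ]
      exact IsPullback.of_hasPullback _ _
    haveI := hEB.isVectorBundle.1
    exact (subsingleton_ext_unit_succ_iff_of_isPullback_specMap ψ.hom Hy EB (IsAffineLocalizing.of_isQuasicoherent EB) 0).mpr hvan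
  obtain ⟨hfin, -⟩ := finite_and_projective_secMod_top_of_forall_fiber f₁ EB hEB hvan₀
  haveI := hfin
  obtain ⟨n, σ, hσ⟩ := Module.Finite.exists_fin (R := Γ(Spec (.of Ω), ⊤)) (M := SecMod EB f₁.appTop.hom ⊤)
  let s : Fin (n + 1) → Γ(EB, ⊤) := Fin.cons 0 fun l ↦ SecMod.val (ρ := f₁.appTop.hom) (σ l)
  have hs : ∀ τ : Γ(EB, ⊤), SecMod.mk (L := EB) (ρ := f₁.appTop.hom) (U := ⊤) τ ∈
      Submodule.span Γ(Spec (.of Ω), ⊤) (Set.range fun l ↦ SecMod.mk (L := EB) (ρ := f₁.appTop.hom) (U := ⊤) (s l)) := by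
    intro τ
    refine Submodule.span_mono ?_ (hσ.symm ▸ Submodule.mem_top)
    rintro _ ⟨l, rfl⟩
    exact ⟨l.succ, by simp only [s, Fin.cons_succ, SecMod.mk_val]⟩
  -- Lefschetz
  obtain ⟨hcov, Hemb⟩ := B.isClosedImmersion_toProj_of_iso_lineBundle_three_nsmul hΘ EB e3 (F.pullback pr)
    (fun z ↦ h1 (pr.base z)) s hs
  exact ⟨n, s, hcov, Hemb⟩

end FibreInputs

/-! ## §2 The chart embeddings -/

section Chart

variable {T : Scheme.{0}} [IsLocallyNoetherian T] (𝒜 : AbelianSchemeOver T)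

/-- **REL-EMB for a rank-one `L` with a symmetric ample char-`0` witness**: `T` locally Noetherian, `x ∈ T`, a field-valued point `x̄` of
characteristic `0` centred at `x` with `L|_{A_x̄} ≅ 𝒪(Θ)`, `Θ` ample and symmetric; THEN there are a Noetherian ring `R` and an affine OPEN
IMMERSION `ι : Spec R → T` through `x` such that for EVERY cartesian square `A′ = A ×_T Spec R` finitely many sections of `L^{⊗3}|_{A′}` generate it
and define a CLOSED IMMERSION `A′ ↪ ℙ^m_R` over `Spec R` (§1 + ★ `exists_affineOpen_isClosedImmersion_toProj`; cf. [EGAIII1] Thm. (4.7.1)).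
[cite: EGAIII1, Thm. (4.7.1) p. 145] [cite: MumfordAV1970, §16 (the vanishing theorem) and §17 (Lefschetz)] -/
theorem exists_affineOpen_isClosedImmersion_toProj_tensorPow_three_of_symmetric_isAmple (L : 𝒜.X.left.Modules) (hL : HasRank L 1)
    (F : FrameSystem (tensorPow L 3)) (h1 : ∀ x, F.rank x = 1) (x : T)
    {Ω : Type} [Field Ω] [CharZero Ω] (xb : Spec (.of Ω) ⟶ T) (hx : x ∈ Set.range xb)
    {Θ : CartierDivisor (𝒜.fibre xb).toAbelianVariety.X.left} (hΘ : Θ.IsAmple)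
    (hsym : (Θ.pullback (AbelianVariety.Hom.toSchemeHom (-𝟙 (𝒜.fibre xb).toAbelianVariety))).LinEquiv Θ)
    (e : Nonempty ((Scheme.Modules.pullback (pullback.fst 𝒜.X.hom xb)).obj L ≅ 𝒜.lineBundleOfDivisor xb Θ)) :
    ∃ (R : Type) (_ : CommRing R) (_ : IsNoetherianRing R) (ι : Spec (.of R) ⟶ T) (_ : IsOpenImmersion ι), x ∈ Set.range ι ∧
      ∀ {X' : Scheme.{0}} (i' : X' ⟶ 𝒜.X.left) (f' : X' ⟶ Spec (.of R)), IsPullback i' f' 𝒜.X.hom ι →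
        ∃ (m : ℕ) (b : Fin (m + 1) → Γ((Scheme.Modules.pullback i').obj (tensorPow L 3), ⊤))
          (hcov' : ⨆ i, ⨆ z, X'.basicOpen ((CocycleSections.ofFrameSystem (F.pullback i') (fun z ↦ h1 (i'.base z))
            b).coeff i z) = ⊤),
          IsClosedImmersion ((ofCocycleSections (F.pullback i').U (CocycleSections.ofFrameSystem (F.pullback i')
            (fun z ↦ h1 (i'.base z)) b) hcov').toProj f') := by
  haveI : IsProper 𝒜.X.hom := 𝒜.isProper
  haveI : Smooth 𝒜.X.hom := 𝒜.isSmooth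
  obtain ⟨hvan, n, s, hcov, H⟩ :=
    𝒜.subsingleton_ext_and_exists_toProj_tensorPow_three_of_symmetric_isAmple L hL F h1 xb hΘ hsym e
  exact exists_affineOpen_isClosedImmersion_toProj 𝒜.X.hom F h1 x xb hx (IsPullback.of_hasPullback _ _) hvan _ s hcov H

/-- **REL-EMB for `L^Δ(λ) = Gr^*𝒫` from `λ̄ = Λ(𝒪(Θ))` at one algebraically closed char-`0` point** (`Θ` ample; [MumfordFogartyKirwan1994] Def. 6.3):
the witness of the previous theorem is `Θ + (−1)^*Θ`, whose class is `[L^Δ(λ)|_{A_x̄}]` (★ `detClass_restrict_LDelta_eq_cechClass_add_pullback_neg`,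
[MumfordFogartyKirwan1994] Prop. 6.10), symmetric and ample ([GortzWedhorn2023] Rem. 27.185).
[cite: MumfordFogartyKirwan1994, Ch. 6 §2 Prop. 6.10 (p. 121) and Def. 6.3 (p. 120)] [cite: EGAIII1, Thm. (4.7.1) p. 145] -/
theorem exists_affineOpen_isClosedImmersion_toProj_LDelta_three_of_isLambdaOfAt (D : 𝒜.DualPair) {lam : 𝒜.X ⟶ D.hat.X}
    (Gr : 𝒜.X.left ⟶ 𝒜.prodLeft D.hat) (hGr₁ : Gr ≫ pullback.fst 𝒜.X.hom D.hat.X.hom = 𝟙 _)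
    (hGr₂ : Gr ≫ pullback.snd 𝒜.X.hom D.hat.X.hom = lam.left)
    (F : FrameSystem (tensorPow ((Scheme.Modules.pullback Gr).obj D.P) 3)) (h1 : ∀ x, F.rank x = 1) (x : T)
    {Ω : Type} [Field Ω] [IsAlgClosed Ω] [CharZero Ω] (xb : Spec (.of Ω) ⟶ T) (hx : x ∈ Set.range xb)
    {Θ : CartierDivisor (𝒜.fibre xb).toAbelianVariety.X.left} (hΘ : Θ.IsAmple) (hΛ : 𝒜.IsLambdaOfAt xb D lam Θ) :
    ∃ (R : Type) (_ : CommRing R) (_ : IsNoetherianRing R) (ι : Spec (.of R) ⟶ T) (_ : IsOpenImmersion ι), x ∈ Set.range ι ∧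
      ∀ {X' : Scheme.{0}} (i' : X' ⟶ 𝒜.X.left) (f' : X' ⟶ Spec (.of R)), IsPullback i' f' 𝒜.X.hom ι →
        ∃ (m : ℕ) (b : Fin (m + 1) → Γ((Scheme.Modules.pullback i').obj (tensorPow ((Scheme.Modules.pullback Gr).obj D.P) 3), ⊤))
          (hcov' : ⨆ i, ⨆ z, X'.basicOpen ((CocycleSections.ofFrameSystem (F.pullback i') (fun z ↦ h1 (i'.base z))
            b).coeff i z) = ⊤),
          IsClosedImmersion ((ofCocycleSections (F.pullback i').U (CocycleSections.ofFrameSystem (F.pullback i')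
            (fun z ↦ h1 (i'.base z)) b) hcov').toProj f') := by
  let B := (𝒜.fibre xb).toAbelianVariety
  haveI : IsIntegral B.X.left :=
    haveI := B.geometricallyIntegral
    GeometricallyIntegral.isIntegral_of_subsingleton B.X.hom
  haveI : IsIntegral (pullback 𝒜.X.hom xb) := ‹IsIntegral B.X.left›
  -- the symmetric ample witness `Θ + (−1)^*Θ`
  let ν : B.X.left ⟶ B.X.left := AbelianVariety.Hom.toSchemeHom (-𝟙 B)
  have hνν : ν ≫ ν = 𝟙 B.X.left := by
    change AbelianVariety.Hom.toSchemeHom ((-𝟙 B) ≫ (-𝟙 B)) = 𝟙 B.X.left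
    rw [Preadditive.neg_comp_neg, Category.comp_id]
    rfl
  haveI : IsIso ν := ⟨ν, hνν, hνν⟩
  let Θs : CartierDivisor B.X.left := Θ + Θ.pullback ν
  have hsym : (Θs.pullback ν).LinEquiv Θs := by
    refine CartierDivisor.SameDivisor.linEquiv ?_
    refine (CartierDivisor.pullback_add_sameDivisor Θ (Θ.pullback ν) ν).trans ?_
    refine CartierDivisor.SameDivisor.trans ?_ (CartierDivisor.add_comm_sameDivisor _ _)
    refine CartierDivisor.SameDivisor.add (CartierDivisor.SameDivisor.refl _) ?_
    refine (CartierDivisor.pullback_pullback_sameDivisor Θ ν ν).trans ?_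
    exact (Θ.pullback_congr_sameDivisor hνν).trans Θ.pullback_id_sameDivisor
  have hamp : Θs.IsAmple := hΘ.add (hΘ.pullback ν)
  have hL : HasRank ((Scheme.Modules.pullback Gr).obj D.P) 1 := hasRank_pullback Gr D.hasRank_one
  have hLf : IsFiniteLocallyFree
      ((Scheme.Modules.pullback (pullback.fst 𝒜.X.hom xb)).obj ((Scheme.Modules.pullback Gr).obj D.P)) :=
    (HasRank.isFiniteLocallyFree' hL).pullback _
  have e : Nonempty ((Scheme.Modules.pullback (pullback.fst 𝒜.X.hom xb)).obj ((Scheme.Modules.pullback Gr).obj D.P) ≅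
      𝒜.lineBundleOfDivisor xb Θs) := by
    refine (nonempty_iso_iff_detClass_eq (hasRank_pullback _ hL) Θs.toUnitCocycle.hasRank_lineBundle hLf
      Θs.toUnitCocycle.isFiniteLocallyFree_lineBundle).2 ?_
    rw [detClass_lineBundle_toUnitCocycle]
    exact 𝒜.detClass_restrict_LDelta_eq_cechClass_add_pullback_neg D xb rfl hΛ Gr hGr₁ hGr₂ hLf
  exact 𝒜.exists_affineOpen_isClosedImmersion_toProj_tensorPow_three_of_symmetric_isAmple _ hL F h1 x xb hx hamp hsym e

/-- **REL-EMB for a POLARISATION at any point of characteristic `0`** ([MumfordFogartyKirwan1994] Def. 6.3: `λ̄ = Λ(𝒪(Θ))` with `Θ` ample at every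
geometric point — ★ `Polarization.exists_ample` at `x̄ := Spec κ(x)̄ → T`): `T` locally Noetherian, `𝒜/T` with a polarisation `pol` (graph `Gr` of
`pol.lam`), `x ∈ T` with `CharZero κ(x)` ⇒ an affine open `Spec R ↪ T` through `x` over which sections of `L^Δ(λ)^{⊗3}|` embed `A ×_T Spec R ↪ ℙ^m_R`.
[cite: MumfordFogartyKirwan1994, Ch. 6 §2 Def. 6.3 (p. 120) and Ch. 7 §2 Prop. 7.6 (p. 136)] [cite: EGAIII1, Thm. (4.7.1) p. 145] -/
theorem exists_affineOpen_isClosedImmersion_toProj_LDelta_three_of_polarization (D : 𝒜.DualPair) (pol : 𝒜.Polarization D)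
    (Gr : 𝒜.X.left ⟶ 𝒜.prodLeft D.hat) (hGr₁ : Gr ≫ pullback.fst 𝒜.X.hom D.hat.X.hom = 𝟙 _)
    (hGr₂ : Gr ≫ pullback.snd 𝒜.X.hom D.hat.X.hom = pol.lam.left)
    (F : FrameSystem (tensorPow ((Scheme.Modules.pullback Gr).obj D.P) 3)) (h1 : ∀ x, F.rank x = 1) (x : T)
    [CharZero (T.residueField x)] :
    ∃ (R : Type) (_ : CommRing R) (_ : IsNoetherianRing R) (ι : Spec (.of R) ⟶ T) (_ : IsOpenImmersion ι), x ∈ Set.range ι ∧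
      ∀ {X' : Scheme.{0}} (i' : X' ⟶ 𝒜.X.left) (f' : X' ⟶ Spec (.of R)), IsPullback i' f' 𝒜.X.hom ι →
        ∃ (m : ℕ) (b : Fin (m + 1) → Γ((Scheme.Modules.pullback i').obj (tensorPow ((Scheme.Modules.pullback Gr).obj D.P) 3), ⊤))
          (hcov' : ⨆ i, ⨆ z, X'.basicOpen ((CocycleSections.ofFrameSystem (F.pullback i') (fun z ↦ h1 (i'.base z))
            b).coeff i z) = ⊤),
          IsClosedImmersion ((ofCocycleSections (F.pullback i').U (CocycleSections.ofFrameSystem (F.pullback i')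
            (fun z ↦ h1 (i'.base z)) b) hcov').toProj f') := by
  let Ω : Type := AlgebraicClosure (T.residueField x)
  let xb : Spec (.of Ω) ⟶ T := Spec.map (CommRingCat.ofHom (algebraMap (T.residueField x) Ω)) ≫ T.fromSpecResidueField x
  have hx : x ∈ Set.range xb := ⟨IsLocalRing.closedPoint Ω, by
    change (Spec.map _ ≫ T.fromSpecResidueField x) _ = x
    rw [Scheme.Hom.comp_apply, Scheme.fromSpecResidueField_apply]⟩
  obtain ⟨Θ, hΘ, hΛ⟩ := pol.exists_ample Ω xb
  exact 𝒜.exists_affineOpen_isClosedImmersion_toProj_LDelta_three_of_isLambdaOfAt D Gr hGr₁ hGr₂ F h1 x xb hx hΘ hΛ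

end Chart

/-! ## §3 Points over the generic point of a characteristic-`0` domain have characteristic-`0` residue fields -/

/-- **`κ(t)` has characteristic `0` when `t` lies over the generic point of `Spec B`**, `B` a domain of characteristic `0`: the composite
`B → κ(⊥) ≅ κ_{Spec B}(q t) → κ(t)` is an injective ring map (`ker (B → κ(𝔭)) = 𝔭 = 0`; field maps are injective). [folklore]
[cite: StacksProject, Tag 00FE] -/
theorem charZero_residueField_of_apply_eq_bot {B : Type} [CommRing B] [IsDomain B] [CharZero B] {T : Scheme.{0}}
    (q : T ⟶ Spec (.of B)) (t : T) (ht : (q t).asIdeal = ⊥) : CharZero (T.residueField t) := by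
  let p : PrimeSpectrum B := q t
  let φ₁ : B →+* p.asIdeal.ResidueField := algebraMap B p.asIdeal.ResidueField
  let φ₂ : p.asIdeal.ResidueField →+* (Spec (.of B)).residueField p := (Scheme.Spec.residueFieldIso (.of B) p).inv.hom
  let φ₃ : (Spec (.of B)).residueField p →+* T.residueField t := (q.residueFieldMap t).hom
  have h₁ : Function.Injective φ₁ := by
    rw [RingHom.injective_iff_ker_eq_bot, Ideal.ker_algebraMap_residueField]
    exact ht
  have h₂ : Function.Injective φ₂ := (Scheme.Spec.residueFieldIso (.of B) p).symm.commRingCatIsoToRingEquiv.injective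
  have h₃ : Function.Injective φ₃ := φ₃.injective
  exact charZero_of_injective_ringHom (f := φ₃.comp (φ₂.comp φ₁)) (h₃.comp (h₂.comp h₁))

/-! ## §4 The spread over a Dedekind base of characteristic `0` -/

/-- **REL-EMB-SPREAD over a Dedekind base** ([EGAIII1] Thm. (4.7.1) at every point of the generic fibre + [EGAIV3] (9.2)): `T` Noetherian,
`q : T → Spec B` locally of finite type, `B` a Dedekind domain of characteristic `0`, `𝒜/T` an abelian scheme with a polarisation `pol` (graph `Gr`
of `pol.lam`) and a rank-one frame system `F` of `L^Δ(λ)^{⊗3} = (Gr^*𝒫)^{⊗3}`.  THEN there is an OPEN `𝒱 ⊆ T` such that (i) `q(T ∖ 𝒱)` is a FINITE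
set of primes of `B` — `T ∖ 𝒱` is closed, hence constructible in the Noetherian `T`, and contains no point over the generic point (§3 + §2), so ★ SP3-b
`finite_image_of_isConstructible_of_bot_notMem_of_finiteType` applies — and (ii) every `t ∈ 𝒱` lies in an affine open `Spec R ↪ 𝒱` (`R` Noetherian)
over which, for every cartesian square `A′ = A ×_T Spec R`, finitely many sections of `L^Δ(λ)^{⊗3}|_{A′}` embed `A′ ↪ ℙ^m_R` over `Spec R`.  The
consumer inverts the finitely many primes (they join `S_M`) and reads (ii) as the (I-EMB) cover of the remaining stage.
[cite: EGAIII1, Thm. (4.7.1) p. 145] [cite: EGAIV3, (9.2.1)–(9.2.3)] [cite: StacksProject, Tag 00FE] [cite: MumfordFogartyKirwan1994, Ch. 7 §2 Prop. 7.6 (p. 136)] -/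
theorem exists_opens_finite_image_compl_forall_affineOpen_isClosedImmersion_toProj
    {B : Type} [CommRing B] [IsDedekindDomain B] [CharZero B] {T : Scheme.{0}} [IsNoetherian T]
    (q : T ⟶ Spec (.of B)) [LocallyOfFiniteType q] (𝒜 : AbelianSchemeOver T) (D : 𝒜.DualPair) (pol : 𝒜.Polarization D)
    (Gr : 𝒜.X.left ⟶ 𝒜.prodLeft D.hat) (hGr₁ : Gr ≫ pullback.fst 𝒜.X.hom D.hat.X.hom = 𝟙 _)
    (hGr₂ : Gr ≫ pullback.snd 𝒜.X.hom D.hat.X.hom = pol.lam.left)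
    (F : FrameSystem (tensorPow ((Scheme.Modules.pullback Gr).obj D.P) 3)) (h1 : ∀ x, F.rank x = 1) :
    ∃ 𝒱 : T.Opens, (q '' ((𝒱 : Set T)ᶜ)).Finite ∧
      ∀ t ∈ 𝒱, ∃ (R : Type) (_ : CommRing R) (_ : IsNoetherianRing R) (ι : Spec (.of R) ⟶ T) (_ : IsOpenImmersion ι),
        t ∈ Set.range ι ∧ Set.range ι ⊆ (𝒱 : Set T) ∧
        ∀ {X' : Scheme.{0}} (i' : X' ⟶ 𝒜.X.left) (f' : X' ⟶ Spec (.of R)), IsPullback i' f' 𝒜.X.hom ι →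
          ∃ (m : ℕ) (b : Fin (m + 1) → Γ((Scheme.Modules.pullback i').obj (tensorPow ((Scheme.Modules.pullback Gr).obj D.P) 3), ⊤))
            (hcov' : ⨆ i, ⨆ z, X'.basicOpen ((CocycleSections.ofFrameSystem (F.pullback i') (fun z ↦ h1 (i'.base z))
              b).coeff i z) = ⊤),
            IsClosedImmersion ((ofCocycleSections (F.pullback i').U (CocycleSections.ofFrameSystem (F.pullback i')
              (fun z ↦ h1 (i'.base z)) b) hcov').toProj f') := by
  classical
  -- the chart at every point over the generic point
  have key : ∀ t : T, (q t).asIdeal = ⊥ →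
      ∃ (R : Type) (_ : CommRing R) (_ : IsNoetherianRing R) (ι : Spec (.of R) ⟶ T) (_ : IsOpenImmersion ι), t ∈ Set.range ι ∧
        ∀ {X' : Scheme.{0}} (i' : X' ⟶ 𝒜.X.left) (f' : X' ⟶ Spec (.of R)), IsPullback i' f' 𝒜.X.hom ι →
          ∃ (m : ℕ) (b : Fin (m + 1) → Γ((Scheme.Modules.pullback i').obj (tensorPow ((Scheme.Modules.pullback Gr).obj D.P) 3), ⊤))
            (hcov' : ⨆ i, ⨆ z, X'.basicOpen ((CocycleSections.ofFrameSystem (F.pullback i') (fun z ↦ h1 (i'.base z))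
              b).coeff i z) = ⊤),
            IsClosedImmersion ((ofCocycleSections (F.pullback i').U (CocycleSections.ofFrameSystem (F.pullback i')
              (fun z ↦ h1 (i'.base z)) b) hcov').toProj f') := fun t ht ↦ by
    haveI := charZero_residueField_of_apply_eq_bot q t ht
    exact 𝒜.exists_affineOpen_isClosedImmersion_toProj_LDelta_three_of_polarization D pol Gr hGr₁ hGr₂ F h1 t
  choose R instR instN ι instι hmem hemb using key
  -- the open: the union of the charts
  let 𝒱 : T.Opens := ⨆ (t : T), ⨆ (ht : (q t).asIdeal = ⊥), (ι t ht).opensRange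
  refine ⟨𝒱, ?_, fun t ht𝒱 ↦ ?_⟩
  · -- `T ∖ 𝒱` is constructible and misses the generic fibre
    have h𝒱c : IsConstructible ((𝒱 : Set T)ᶜ) :=
      isConstructible_compl.mpr (IsRetrocompact.isConstructible 𝒱.isOpen fun U _ _ ↦ NoetherianSpace.isCompact _)
    refine finite_image_of_isConstructible_of_bot_notMem_of_finiteType q h𝒱c ?_
    rintro ⟨t, htZ, hqt⟩
    apply htZ
    have ht : (q t).asIdeal = ⊥ := by rw [hqt]; rfl
    change t ∈ 𝒱
    exact Opens.mem_iSup.mpr ⟨t, Opens.mem_iSup.mpr ⟨ht, hmem t ht⟩⟩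
  · obtain ⟨t', ht'⟩ := Opens.mem_iSup.mp ht𝒱
    obtain ⟨hq, htm⟩ := Opens.mem_iSup.mp ht'
    refine ⟨R t' hq, instR t' hq, instN t' hq, ι t' hq, instι t' hq, htm, ?_, fun i' f' H ↦ hemb t' hq i' f' H⟩
    intro z hz
    change z ∈ 𝒱
    exact Opens.mem_iSup.mpr ⟨t', Opens.mem_iSup.mpr ⟨hq, hz⟩⟩


/-- **REL-EMB-SPREAD, ED. 2 — THE OPEN `𝒱` CONTAINS THE GENERIC FIBRE** (add-only twin of the preceding theorem, whose PROOF builds `𝒱` from the charts at the points over `⊥` but whose STATEMENT only records `q(T ∖ 𝒱)` finite, allowing `⊥` among the bad primes): same hypotheses, conclusion `∧ ∀ t, (q t).asIdeal = ⊥ → t ∈ 𝒱` — the `stub_INJ0` stage inverts the finitely many NON-ZERO bad primes and keeps the generic fibre.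
[cite: EGAIII1, Thm. (4.7.1) p. 145] [cite: EGAIV3, (9.2.1)–(9.2.3)] [cite: MumfordFogartyKirwan1994, Ch. 7 §2 Prop. 7.6 (p. 136)] -/
theorem exists_opens_finite_image_compl_forall_affineOpen_isClosedImmersion_toProj'
    {B : Type} [CommRing B] [IsDedekindDomain B] [CharZero B] {T : Scheme.{0}} [IsNoetherian T]
    (q : T ⟶ Spec (.of B)) [LocallyOfFiniteType q] (𝒜 : AbelianSchemeOver T) (D : 𝒜.DualPair) (pol : 𝒜.Polarization D)
    (Gr : 𝒜.X.left ⟶ 𝒜.prodLeft D.hat) (hGr₁ : Gr ≫ pullback.fst 𝒜.X.hom D.hat.X.hom = 𝟙 _)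
    (hGr₂ : Gr ≫ pullback.snd 𝒜.X.hom D.hat.X.hom = pol.lam.left)
    (F : FrameSystem (tensorPow ((Scheme.Modules.pullback Gr).obj D.P) 3)) (h1 : ∀ x, F.rank x = 1) :
    ∃ 𝒱 : T.Opens, (q '' ((𝒱 : Set T)ᶜ)).Finite ∧ (∀ t : T, (q t).asIdeal = ⊥ → t ∈ 𝒱) ∧
      ∀ t ∈ 𝒱, ∃ (R : Type) (_ : CommRing R) (_ : IsNoetherianRing R) (ι : Spec (.of R) ⟶ T) (_ : IsOpenImmersion ι),
        t ∈ Set.range ι ∧ Set.range ι ⊆ (𝒱 : Set T) ∧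
        ∀ {X' : Scheme.{0}} (i' : X' ⟶ 𝒜.X.left) (f' : X' ⟶ Spec (.of R)), IsPullback i' f' 𝒜.X.hom ι →
          ∃ (m : ℕ) (b : Fin (m + 1) → Γ((Scheme.Modules.pullback i').obj (tensorPow ((Scheme.Modules.pullback Gr).obj D.P) 3), ⊤))
            (hcov' : ⨆ i, ⨆ z, X'.basicOpen ((CocycleSections.ofFrameSystem (F.pullback i') (fun z ↦ h1 (i'.base z))
              b).coeff i z) = ⊤),
            IsClosedImmersion ((ofCocycleSections (F.pullback i').U (CocycleSections.ofFrameSystem (F.pullback i')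
              (fun z ↦ h1 (i'.base z)) b) hcov').toProj f') := by
  classical
  -- the chart at every point over the generic point
  have key : ∀ t : T, (q t).asIdeal = ⊥ →
      ∃ (R : Type) (_ : CommRing R) (_ : IsNoetherianRing R) (ι : Spec (.of R) ⟶ T) (_ : IsOpenImmersion ι), t ∈ Set.range ι ∧
        ∀ {X' : Scheme.{0}} (i' : X' ⟶ 𝒜.X.left) (f' : X' ⟶ Spec (.of R)), IsPullback i' f' 𝒜.X.hom ι →
          ∃ (m : ℕ) (b : Fin (m + 1) → Γ((Scheme.Modules.pullback i').obj (tensorPow ((Scheme.Modules.pullback Gr).obj D.P) 3), ⊤))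
            (hcov' : ⨆ i, ⨆ z, X'.basicOpen ((CocycleSections.ofFrameSystem (F.pullback i') (fun z ↦ h1 (i'.base z))
              b).coeff i z) = ⊤),
            IsClosedImmersion ((ofCocycleSections (F.pullback i').U (CocycleSections.ofFrameSystem (F.pullback i')
              (fun z ↦ h1 (i'.base z)) b) hcov').toProj f') := fun t ht ↦ by
    haveI := charZero_residueField_of_apply_eq_bot q t ht
    exact 𝒜.exists_affineOpen_isClosedImmersion_toProj_LDelta_three_of_polarization D pol Gr hGr₁ hGr₂ F h1 t
  choose R instR instN ι instι hmem hemb using key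
  -- the open: the union of the charts
  let 𝒱 : T.Opens := ⨆ (t : T), ⨆ (ht : (q t).asIdeal = ⊥), (ι t ht).opensRange
  refine ⟨𝒱, ?_, fun t ht ↦ ?_, fun t ht𝒱 ↦ ?_⟩
  · -- `T ∖ 𝒱` is constructible and misses the generic fibre
    have h𝒱c : IsConstructible ((𝒱 : Set T)ᶜ) :=
      isConstructible_compl.mpr (IsRetrocompact.isConstructible 𝒱.isOpen fun U _ _ ↦ NoetherianSpace.isCompact _)
    refine finite_image_of_isConstructible_of_bot_notMem_of_finiteType q h𝒱c ?_
    rintro ⟨t, htZ, hqt⟩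
    apply htZ
    have ht : (q t).asIdeal = ⊥ := by rw [hqt]; rfl
    change t ∈ 𝒱
    exact Opens.mem_iSup.mpr ⟨t, Opens.mem_iSup.mpr ⟨ht, hmem t ht⟩⟩
  · -- the generic fibre lies in `𝒱` (every point over `⊥` has its chart)
    exact Opens.mem_iSup.mpr ⟨t, Opens.mem_iSup.mpr ⟨ht, hmem t ht⟩⟩
  · obtain ⟨t', ht'⟩ := Opens.mem_iSup.mp ht𝒱
    obtain ⟨hq, htm⟩ := Opens.mem_iSup.mp ht'
    refine ⟨R t' hq, instR t' hq, instN t' hq, ι t' hq, instι t' hq, htm, ?_, fun i' f' H ↦ hemb t' hq i' f' H⟩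
    intro z hz
    change z ∈ 𝒱
    exact Opens.mem_iSup.mpr ⟨t', Opens.mem_iSup.mpr ⟨hq, hz⟩⟩


end AbelianSchemeOver

end Literature.AlgebraicGeometry.AbelianSchemes

end
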